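import Mathlib
import Summits.SmoothPoincare4.SmoothPoincare4.Theorems.CylinderEntropyCylinderRungTwoKCertSoundTabOK
import Summits.SmoothPoincare4.SmoothPoincare4.Theorems.CylinderEntropyCylinderRungTwoKCertSoundE
import Summits.SmoothPoincare4.SmoothPoincare4.Theorems.CylinderEntropyCylinderRungTwoKCertSoundBox
import HarnessLib

/-!
# Kernel certificate checker for `stub_certMid`, VII: soundness of the end-point data

Infrastructure file for the kernel-clean discharge of the registered stub `stub_certMid` of crux stmt-SmoothPoincare4-7631
(`Summit.SmoothPoincare4.SmoothPoincare4.Theses.CylinderEntropy.CylinderRungTwo`, line `killing-flux`).  The real objects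
of the certificate (`G_j(u) = e^{-(u-σ_j)²/(4τ_j)}`, `R = c + Σ w_j G_j Z_j`), the semantic invariants `UDok` / `TDok` of the
`u`- and `θ`-end-point data of a box, and their proofs for the computed data `mkUD`, `mkTDh`; the corner bounds
`eCorner ≥ S · sup_T E_T` and `rCorner ≤ S · R`.
No named facts.
-/

-- the registered namespace `Summit.SmoothPoincare4.SmoothPoincare4.…` repeats a component
set_option linter.dupNamespace false

noncomputable section

namespace Summit.SmoothPoincare4.SmoothPoincare4.Cruxes.CylinderRungTwo.KillingFlux

namespace KCert

open Set
open Literature.Analysis.ValidatedNumerics.NumericsMP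
open Summit.SmoothPoincare4.SmoothPoincare4.Theorems.CylinderEntropySliceIsolation
open Summit.SmoothPoincare4.SmoothPoincare4.Theorems.CylinderEntropySliceIsolation.Cert

variable (C : KCell)

/-! ### Real objects -/

/-- The certificate `R(u, θ) = c + Σ_j w_j G_j(u) Zc_j(θ)` (list form). [folklore] -/
def KCell.R (C : KCell) (u θ : ℝ) : ℝ := (C.c : ℝ) + (C.atoms.map fun a => (a.w : ℝ) * a.G u * a.Zc θ).sum

/-! ### The `u`-end-point data -/

/-- **Invariant of a `u`-end-point datum**: `x` encloses `e^u` (`0 ≤ x.lo`); `0 ≤ glo_j ≤ G_j(u) S ≤ ghi_j`, lists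
aligned with the atoms. [folklore] -/
def UDok (U : UD) : Prop :=
  (MI.mem S64 (Real.exp (U.u : ℝ)) U.x ∧ 0 ≤ U.x.lo) ∧
    List.Forall₂ (fun (a : KAtom) (g : ℤ) => 0 ≤ g ∧ ((g : ℤ) : ℝ) ≤ a.G U.u * S64) C.atoms U.glo ∧
    List.Forall₂ (fun (a : KAtom) (g : ℤ) => a.G U.u * S64 ≤ ((g : ℤ) : ℝ)) C.atoms U.ghi

/-- **The computed `u`-data are valid.** [folklore] -/
theorem mkUD_ok (hat : atomsOK C C.atoms = true) (u : ℚ) : UDok C (mkUD C u) := by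
  have hA := atomsOK_forall C hat
  refine ⟨⟨⟨zlo64_le_of_le (expLo_le _ _), le_zhi64_of_le (exp_le_expHi _ _)⟩,
    Int.floor_nonneg.2 (mul_nonneg (expLo_nonneg _ _) (by norm_num [S64]))⟩, ?_, ?_⟩
  · simp only [mkUD]
    rw [List.forall₂_map_right_iff]
    refine List.forall₂_same.2 fun a ham => ?_
    refine ⟨Int.floor_nonneg.2 (mul_nonneg (expLo_nonneg _ _) (by norm_num [S64])), ?_⟩
    exact zlo64_le_of_le (G_bounds C (hA a ham) u).1
  · simp only [mkUD]
    rw [List.forall₂_map_right_iff]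
    refine List.forall₂_same.2 fun a ham => ?_
    exact le_zhi64_of_le (G_bounds C (hA a ham) u).2

/-! ### Grid index searches -/

/-- `idxBelowIn` returns an index `i ≤ hi` with `thi_i ≤ t`, or `0`. [folklore] -/
theorem idxBelowIn_spec (grid : List GridPt) (t : ℚ) (lo hi : ℕ) :
    idxBelowIn grid t lo hi = 0 ∨ (idxBelowIn grid t lo hi ≤ hi ∧ (grid.getD (idxBelowIn grid t lo hi) gridD).thi ≤ t) := by
  unfold idxBelowIn
  -- general invariant of the fold over any list of indices `≤ hi`
  suffices h : ∀ (l : List ℕ) (b : ℕ), (∀ i ∈ l, i ≤ hi) → (b = 0 ∨ (b ≤ hi ∧ (grid.getD b gridD).thi ≤ t)) →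
      (l.foldl (fun best i => if (grid.getD i gridD).thi ≤ t then i else best) b = 0 ∨
        (l.foldl (fun best i => if (grid.getD i gridD).thi ≤ t then i else best) b ≤ hi ∧
          (grid.getD (l.foldl (fun best i => if (grid.getD i gridD).thi ≤ t then i else best) b) gridD).thi ≤ t)) by
    refine h _ 0 ?_ (Or.inl rfl)
    intro i hi'
    simp only [List.mem_map, List.mem_range] at hi'
    obtain ⟨k, hk, rfl⟩ := hi'
    omega
  intro l
  induction l with
  | nil => intro b _ hb; simpa using hb
  | cons j l ih =>
    intro b hl hb
    simp only [List.foldl_cons]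
    refine ih _ (fun i hi' => hl i (List.mem_cons_of_mem _ hi')) ?_
    split_ifs with hj
    · exact Or.inr ⟨hl j (List.mem_cons_self ..), hj⟩
    · exact hb

/-- `idxAboveIn` returns an index `i` with `t ≤ tlo_i`, or the last index. [folklore] -/
theorem idxAboveIn_spec (grid : List GridPt) (t : ℚ) (lo hi : ℕ) :
    idxAboveIn grid t lo hi = grid.length - 1 ∨
      (idxAboveIn grid t lo hi ≤ hi ∧ t ≤ (grid.getD (idxAboveIn grid t lo hi) gridD).tlo) := by
  unfold idxAboveIn
  cases hf : ((List.range (hi + 1 - lo)).map (· + lo)).find? (fun i => decide (t ≤ (grid.getD i gridD).tlo)) with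
  | none => left; simp
  | some i =>
    right
    simp only [Option.getD_some]
    have h1 := List.find?_some hf
    have h2 := List.mem_of_find?_eq_some hf
    simp only [decide_eq_true_eq] at h1
    simp only [List.mem_map, List.mem_range] at h2
    obtain ⟨k, hk, rfl⟩ := h2
    exact ⟨by omega, h1⟩

/-! ### The `θ`-end-point data -/

/-- The real angle of a `θ`-end point `t`: `θ̂ = min t π`. [folklore] -/
def TD.th (T : TD) : ℝ := min (T.t : ℝ) Real.pi

/-- **Invariant of a `θ`-end-point datum** (w.r.t. validated tables `tabs`): `0 ≤ t`; `cs` encloses `cos θ̂` within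
`[-S, S]`; `ia, ib < N` with `θ_ia ≤ θ̂ ≤ θ_ib`; `0 ≤ tfl_j ≤ Zc_j(θ̂) S`; `e^{-t²/(4τ_j)} S ≤ hup_j`. [folklore] -/
def TDok (T : TD) : Prop :=
  0 ≤ T.t ∧ MI.mem S64 (Real.cos T.th) T.cs ∧ -(S64 : ℤ) ≤ T.cs.lo ∧ T.cs.hi ≤ S64 ∧
    T.ia < C.grid.length ∧ T.ib < C.grid.length ∧ C.th T.ia ≤ T.th ∧ T.th ≤ C.th T.ib ∧
    List.Forall₂ (fun (a : KAtom) (f : ℤ) => 0 ≤ f ∧ ((f : ℤ) : ℝ) ≤ a.Zc T.th * S64) C.atoms T.tfl ∧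
    List.Forall₂ (fun (a : KAtom) (h : ℤ) => Real.exp (-(T.t : ℝ) ^ 2 / (4 * a.tau)) * S64 ≤ ((h : ℤ) : ℝ)) C.atoms T.hup

/-- `0 ≤ θ̂ ≤ π` for `0 ≤ t`. [folklore] -/
theorem TD.th_mem {T : TD} (h : 0 ≤ T.t) : 0 ≤ T.th ∧ T.th ≤ Real.pi :=
  ⟨le_min (by exact_mod_cast h) Real.pi_pos.le, min_le_right _ _⟩

/-- **The tangent-form lower bound is valid**: for a validated table of the atom, `θ_ia ≤ θ̂`, `ia < N`, `0 ≤ t`: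
`0 ≤ tflOf ≤ Zc θ̂`. [folklore] -/
theorem tflOf_spec {a : KAtom} (ha : atomOK C a = true) (hg : gridOK C = true) {tab : List TabE} (htab : TabOK C a tab)
    {ia : ℕ} (hia : ia < C.grid.length) {t : ℚ} (hθ : C.th ia ≤ min (t : ℝ) Real.pi) :
    0 ≤ tflOf C a tab ia t ∧ ((tflOf C a tab ia t : ℚ) : ℝ) ≤ a.Zc (min (t : ℝ) Real.pi) := by
  obtain ⟨_, hpt, _⟩ := gridOK_sound C hg
  obtain ⟨hz0, hzlo, _, hm0, hmlo, _⟩ := htab.2 ia hia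
  have hτ := tau_pos C ha
  obtain ⟨_, _, _, htlo, htloτ, _, _⟩ := atomOK_sound C ha
  have htlo0 : (0 : ℝ) < a.tlo := by exact_mod_cast htlo
  set g := C.grid.getD ia gridD with hg'
  set e := tab.getD ia tabD with he
  obtain ⟨_, _, htl0, htl, hth', _⟩ := hpt ia hia
  rw [← hg'] at htl0 htl hth'
  have hθg : C.th ia = g.theta := rfl
  set θh : ℝ := min (t : ℝ) Real.pi with hθh
  unfold tflOf
  rw [← he, ← hg']
  dsimp only
  split_ifs with hpos
  · refine ⟨le_max_left _ _, ?_⟩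
    push_cast
    refine max_le (Zc_pos C ha _).le ?_
    have hzi' : (0 : ℝ) < ((e.zlo : ℚ) : ℝ) := by exact_mod_cast hpos
    refine le_trans (mul_le_mul_of_nonneg_left (expLo_le _ _) hzi'.le) ?_
    refine Zc_ge_tangent C ha (hθg ▸ hθ) (hθg ▸ hmlo) hzi' (hθg ▸ hzlo) ?_
    push_cast
    -- `m (min t πlo - thi) ≤ m (θ̂ - θ_ia)` and `(θ̂² - θ_ia²)/(4τ) ≤ (t² - tlo²)/(4 tlo)`
    have hm0' : (0 : ℝ) ≤ ((e.mlo : ℚ) : ℝ) := by exact_mod_cast hm0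
    have htl' : ((min t piLo : ℚ) : ℝ) ≤ θh := by
      push_cast
      exact min_le_min le_rfl piLo_lt_pi.le
    have h1 : ((e.mlo : ℚ) : ℝ) * (((min t piLo : ℚ) : ℝ) - g.thi) ≤ ((e.mlo : ℚ) : ℝ) * (θh - g.theta) :=
      mul_le_mul_of_nonneg_left (by linarith) hm0'
    have hθ0 : 0 ≤ g.theta := le_trans (by exact_mod_cast htl0) htl
    have hθle : g.theta ≤ θh := hθg ▸ hθ
    have hθht : θh ≤ (t : ℝ) := min_le_left _ _
    have hp1 : θh ^ 2 ≤ (t : ℝ) ^ 2 := pow_le_pow_left₀ (hθ0.trans hθle) hθht 2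
    have hp2 : (g.tlo : ℝ) ^ 2 ≤ g.theta ^ 2 := pow_le_pow_left₀ (by exact_mod_cast htl0) htl 2
    have hp3 : g.theta ^ 2 ≤ θh ^ 2 := pow_le_pow_left₀ hθ0 hθle 2
    have h2 : (θh ^ 2 - g.theta ^ 2) / (4 * a.tau) ≤ ((t : ℝ) ^ 2 - (g.tlo : ℝ) ^ 2) / (4 * a.tlo) := by
      calc (θh ^ 2 - g.theta ^ 2) / (4 * a.tau) ≤ (θh ^ 2 - g.theta ^ 2) / (4 * a.tlo) := by
            apply div_le_div_of_nonneg_left (by linarith) (by positivity); linarith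
        _ ≤ ((t : ℝ) ^ 2 - (g.tlo : ℝ) ^ 2) / (4 * a.tlo) := div_le_div_of_nonneg_right (by linarith) (by positivity)
    have e1 : ((min t piLo : ℚ) : ℝ) = min (t : ℝ) ((piLo : ℚ) : ℝ) := by push_cast; rfl
    rw [e1] at h1 htl'
    linarith
  · exact ⟨le_rfl, by push_cast; exact (Zc_pos C ha _).le⟩

/-- **The computed `θ`-data are valid** (hinted index ranges below `N`). [folklore] -/
theorem mkTDh_ok (hat : atomsOK C C.atoms = true) (hg : gridOK C = true) {tabs : List (List TabE)}
    (htabs : List.Forall₂ (TabOK C) C.atoms tabs) {t : ℚ} (ht : 0 ≤ t) {iaLo iaHi ibLo ibHi : ℕ}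
    (hiaHi : iaHi < C.grid.length) (hibHi : ibHi < C.grid.length) :
    TDok C (mkTDh C tabs t iaLo iaHi ibLo ibHi) := by
  have hA := atomsOK_forall C hat
  obtain ⟨hn2, hpt, hθ0, hθN, hNl, _⟩ := gridOK_sound C hg
  set θh : ℝ := min (t : ℝ) Real.pi with hθh
  have hθh0 : 0 ≤ θh := le_min (by exact_mod_cast ht) Real.pi_pos.le
  have hθhπ : θh ≤ Real.pi := min_le_right _ _
  -- the two indices
  set ia := idxBelowIn C.grid (min t piLo) iaLo iaHi with hia
  set ib := idxAboveIn C.grid t ibLo ibHi with hib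
  have hia' : ia < C.grid.length ∧ C.th ia ≤ θh := by
    rcases idxBelowIn_spec C.grid (min t piLo) iaLo iaHi with h0 | ⟨h1, h2⟩
    · rw [← hia] at h0; rw [h0]
      exact ⟨by omega, by show (C.grid.getD 0 gridD).theta ≤ θh; rw [hθ0]; exact hθh0⟩
    · rw [← hia] at h1 h2
      have hlt : ia < C.grid.length := by omega
      refine ⟨hlt, ?_⟩
      have := (hpt ia hlt).2.2.2.2.1
      refine this.trans ?_
      have h2' : (((C.grid.getD ia gridD).thi : ℚ) : ℝ) ≤ ((min t piLo : ℚ) : ℝ) := by exact_mod_cast h2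
      refine h2'.trans ?_
      push_cast
      exact min_le_min le_rfl piLo_lt_pi.le
  have hib' : ib < C.grid.length ∧ θh ≤ C.th ib := by
    rcases idxAboveIn_spec C.grid t ibLo ibHi with h0 | ⟨h1, h2⟩
    · rw [← hib] at h0; rw [h0]
      exact ⟨by omega, by show θh ≤ (C.grid.getD (C.grid.length - 1) gridD).theta; rw [hθN]; exact hθhπ⟩
    · rw [← hib] at h1 h2
      have hlt : ib < C.grid.length := by omega
      refine ⟨hlt, ?_⟩
      have := (hpt ib hlt).2.2.2.1
      refine le_trans ?_ this
      exact (min_le_left _ _).trans (by exact_mod_cast h2)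
  obtain ⟨hcs, hlo, hhi⟩ := cosAtI_spec ht
  refine ⟨ht, hcs, hlo, hhi, hia'.1, hib'.1, hia'.2, hib'.2, ?_, ?_⟩
  · -- tfl
    show List.Forall₂ _ C.atoms ((List.range C.atoms.length).map fun j =>
      zlo64 (tflOf C (C.atoms.getD j atomD) (tabs.getD j []) ia t))
    rw [List.forall₂_iff_get]
    refine ⟨by simp, fun j hj hj' => ?_⟩
    simp only [List.get_eq_getElem, List.getElem_map, List.getElem_range]
    have hatom : C.atoms.getD j atomD = C.atoms[j] := List.getD_eq_getElem _ _ hj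
    have hlen : tabs.length = C.atoms.length := (List.Forall₂.length_eq htabs).symm
    have htab : TabOK C C.atoms[j] (tabs.getD j []) := by
      rw [List.getD_eq_getElem _ _ (by omega)]
      exact List.Forall₂.get htabs hj (by omega)
    rw [hatom]
    obtain ⟨h0, h1⟩ := tflOf_spec C (hA _ (List.getElem_mem hj)) hg htab hia'.1 hia'.2
    exact ⟨Int.floor_nonneg.2 (mul_nonneg (by exact_mod_cast h0) (by norm_num [S64])), zlo64_le_of_le h1⟩
  · -- hup
    have hh : (mkTDh C tabs t iaLo iaHi ibLo ibHi).hup =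
        C.atoms.map (fun a => zhi64 (Cert.expHi (-t ^ 2 / (4 * a.thi)) C.prec)) := rfl
    have htt : (mkTDh C tabs t iaLo iaHi ibLo ibHi).t = t := rfl
    rw [hh, htt, List.forall₂_map_right_iff]
    refine List.forall₂_same.2 fun a ham => ?_
    have ha := hA a ham
    have hτ := tau_pos C ha
    obtain ⟨_, _, _, htlo, htloτ, hτthi, _⟩ := atomOK_sound C ha
    refine le_zhi64_of_le (le_trans (Real.exp_le_exp.2 ?_) (exp_le_expHi _ _))
    push_cast
    rw [neg_div, neg_div, neg_le_neg_iff]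
    exact div_le_div_of_nonneg_left (sq_nonneg _) (by positivity) (by linarith)

/-- `mkTD` (full-range search) is valid. [folklore] -/
theorem mkTD_ok (hat : atomsOK C C.atoms = true) (hg : gridOK C = true) {tabs : List (List TabE)}
    (htabs : List.Forall₂ (TabOK C) C.atoms tabs) {t : ℚ} (ht : 0 ≤ t) : TDok C (mkTD C tabs t) := by
  have := (gridOK_sound C hg).1
  exact mkTDh_ok C hat hg htabs ht (by omega) (by omega)

/-! ### The corner bounds -/

/-- **The corner upper bound**: `S · E_T(u, θ̂) ≤ eCorner` for every `T ∈ [T₁, T₂]` (`0 < T₁`). [folklore] -/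
theorem eCorner_spec (hT1 : 0 < C.T1) {U : UD} (hU : UDok C U) {T : TD} (hT : TDok C T) {T' : ℝ}
    (h1 : ((C.T1 : ℚ) : ℝ) ≤ T') (h2 : T' ≤ ((C.T2 : ℚ) : ℝ)) : Ek T' U.u T.th * S64 ≤ ((eCorner C U T : ℤ) : ℝ) := by
  obtain ⟨⟨hx, _⟩, _, _⟩ := hU
  obtain ⟨_, hcs, hlo, hhi, _⟩ := hT
  unfold eCorner eUpperQ
  refine le_zhi64_of_le ?_
  have hchi1 : -1 ≤ toQ T.cs.hi := by
    unfold toQ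
    rw [le_div_iff₀ (by norm_num [S64])]
    have h := hcs.1.trans hcs.2
    have hl : (-(S64 : ℤ) : ℝ) ≤ (T.cs.hi : ℝ) := le_trans (by exact_mod_cast hlo) h
    have : (-(S64 : ℤ) : ℚ) ≤ (T.cs.hi : ℚ) := by exact_mod_cast (show -(S64 : ℤ) ≤ T.cs.hi by exact_mod_cast hl)
    push_cast at this; linarith
  have hchi2 : toQ T.cs.hi ≤ 1 := by
    unfold toQ
    rw [div_le_iff₀ (by norm_num [S64])]
    have : ((T.cs.hi : ℤ) : ℚ) ≤ ((S64 : ℤ) : ℚ) := by exact_mod_cast hhi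
    push_cast at this; linarith
  exact Ek_upper C.prec hT1 h1 h2 (toQ_le_of hx.1) (le_toQ_of hx.2) (le_toQ_of hcs.2) hchi1 hchi2

/-- The sum in `rCorner` is below `S · Σ w_j G_j Z_j`. [folklore] -/
theorem rCorner_sum_le {atoms : List KAtom} (hA : ∀ a ∈ atoms, atomOK C a = true) {glo tfl : List ℤ} {u θ : ℝ}
    (hg : List.Forall₂ (fun (a : KAtom) (g : ℤ) => 0 ≤ g ∧ ((g : ℤ) : ℝ) ≤ a.G u * S64) atoms glo)
    (hf : List.Forall₂ (fun (a : KAtom) (f : ℤ) => 0 ≤ f ∧ ((f : ℤ) : ℝ) ≤ a.Zc θ * S64) atoms tfl) :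
    (((List.zipWith3 (fun (a : KAtom) (g f : ℤ) => mul3lo (zlo64 a.w) g f) atoms glo tfl).sum : ℤ) : ℝ) ≤
      (atoms.map fun a => (a.w : ℝ) * a.G u * a.Zc θ).sum * S64 := by
  induction hg generalizing tfl with
  | nil => cases hf; simp
  | @cons a g as gs hag _ ih =>
    cases hf with
    | cons haf hf' =>
      rename_i f fs
      simp only [List.zipWith3, List.sum_cons, List.map_cons, Int.cast_add]
      have hA' : ∀ b ∈ as, atomOK C b = true := fun b hb => hA b (List.mem_cons_of_mem _ hb)
      have hw : 0 ≤ a.w := (atomOK_sound C (hA a (List.mem_cons_self ..))).2.2.1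
      have hw0 : 0 ≤ zlo64 a.w := Int.floor_nonneg.2 (mul_nonneg hw (by norm_num [S64]))
      have hwle : ((zlo64 a.w : ℤ) : ℝ) ≤ (a.w : ℝ) * S64 := zlo64_le a.w
      have h1 := mul3lo_le hw0 hag.1 haf.1 hwle hag.2 haf.2
      have h2 := ih hA' hf'
      rw [add_mul]
      exact add_le_add h1 h2

/-- **The corner lower bound**: `rCorner ≤ S · R(u, θ̂)`. [folklore] -/
theorem rCorner_spec (hat : atomsOK C C.atoms = true) {U : UD} (hU : UDok C U) {T : TD} (hT : TDok C T) :
    ((rCorner C U T : ℤ) : ℝ) ≤ C.R U.u T.th * S64 := by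
  obtain ⟨_, hglo, _⟩ := hU
  obtain ⟨_, _, _, _, _, _, _, _, htfl, _⟩ := hT
  unfold rCorner KCell.R
  rw [Int.cast_add, add_mul]
  exact add_le_add (zlo64_le C.c) (rCorner_sum_le C (atomsOK_forall C hat) hglo htfl)

end KCert


/-- Registered sub-goal marker `stub_certMid_part8` of crux stmt-SmoothPoincare4-7631 (helper file 8 of the kernel-clean
`stub_certMid`, line killing-flux): the Gaussian factor of an atom is positive. [folklore] -/
theorem stub_certMid_part8 : ∀ (a : KCert.KAtom) (u : ℝ), 0 < Real.exp (-(u - a.σ) ^ 2 / (4 * a.tau)) :=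
  fun _ _ => Real.exp_pos _

end Summit.SmoothPoincare4.SmoothPoincare4.Cruxes.CylinderRungTwo.KillingFlux

end
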